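import Summits.AtomisticToContinuum.HydrodynamicLimit.Theorems.ImplosionDichotomyPolynomialCompressionUniquenessPrimitive

/-!
# Level-1 forcing expansion: spatial derivatives of the right-hand sides of the difference system

Helper file for the line `log-lipschitz-budget` of the crux
`ImplosionDichotomy.PolynomialCompression` (stmt-AtomisticToContinuum-12587), stub
`stub_logBudgetShadowing` (energy method at derivative level 1). Setting: a classical solution
`V = (ρ, u, θ)` of the hard-sphere Euler system on `[0, T) × 𝕋³` (`IsHardSphereEulerSolution σ T`)
with pressure law `ρ θ ζ(ρ)`, `ζ` smooth on an open set `J ⊇ ρ([0, T) × 𝕋³)`, and the ideal-gas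
REFERENCE `V₁ = (ρ₁, u₁, θ₁)` (`IsHardSphereEulerSolution 0 T`, law `ζ₂ ≡ 1`). By
`hsEuler_difference_density/velocity/temperature` (file `…DifferenceSystem`, there with general
`ζ₂`; here `ζ₂ ≡ 1`, `ζ₂' ≡ 0` already simplified) the difference `δV = V - V₁` solves the
frozen-coefficient linearised system `P_V(δV) = f` with the explicit right-hand sides
(`∂ᵢ = Torus.partialDeriv i`, `γ(ρ) = ζ(ρ) + ρ ζ'(ρ)`, `D₁ = Σᵢ ∂ᵢu₁ᵢ`)

* `f_ρ = -δρ D₁ - Σᵢ δuᵢ ∂ᵢρ₁`,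
* `f_uⱼ = -Σᵢ δuᵢ ∂ᵢu₁ⱼ - (θ γ(ρ)/ρ - θ₁/ρ₁) ∂ⱼρ₁ - (ζ(ρ) - 1) ∂ⱼθ₁`,
* `f_θ = -Σᵢ δuᵢ ∂ᵢθ₁ - (2/3) (θ ζ(ρ) - θ₁) D₁`.

Level 1 of the energy method applies the frozen identity to `W = ∂ₗδV`, whose forcing is
`∂ₗf` minus a one-step commutator. This file is the LEIBNIZ EXPANSION of `∂ₗf`, pointwise on
`[0, T) × 𝕋³`, for each component and each direction `l` (and velocity index `j`):

* `hsEuler_difference_rhs_deriv_density`: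
  `∂ₗf_ρ = -∂ₗδρ D₁ - δρ Σᵢ ∂ₗ∂ᵢu₁ᵢ - Σᵢ ∂ₗδuᵢ ∂ᵢρ₁ - Σᵢ δuᵢ ∂ₗ∂ᵢρ₁`;
* `hsEuler_difference_rhs_deriv_velocity`:
  `∂ₗf_uⱼ = -Σᵢ ∂ₗδuᵢ ∂ᵢu₁ⱼ - Σᵢ δuᵢ ∂ₗ∂ᵢu₁ⱼ - (∂ₗ[θγ(ρ)/ρ] - ∂ₗ[θ₁/ρ₁]) ∂ⱼρ₁
    - (θγ(ρ)/ρ - θ₁/ρ₁) ∂ₗ∂ⱼρ₁ - ζ'(ρ) ∂ₗρ ∂ⱼθ₁ - (ζ(ρ) - 1) ∂ₗ∂ⱼθ₁`, with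
  `∂ₗ[θγ(ρ)/ρ] = (∂ₗθ γ(ρ) + θ (2ζ'(ρ) + ρ ζ''(ρ)) ∂ₗρ)/ρ - θ γ(ρ) ∂ₗρ/ρ²` and
  `∂ₗ[θ₁/ρ₁] = ∂ₗθ₁/ρ₁ - θ₁ ∂ₗρ₁/ρ₁²` written out;
* `hsEuler_difference_rhs_deriv_temperature`:
  `∂ₗf_θ = -Σᵢ ∂ₗδuᵢ ∂ᵢθ₁ - Σᵢ δuᵢ ∂ₗ∂ᵢθ₁ - (2/3) (∂ₗθ ζ(ρ) + θ ζ'(ρ) ∂ₗρ - ∂ₗθ₁) D₁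
    - (2/3) (θ ζ(ρ) - θ₁) Σᵢ ∂ₗ∂ᵢu₁ᵢ`.

The right-hand sides are polynomial in the values of the fields, `ζ(ρ), ζ'(ρ), ζ''(ρ)`
(`deriv ζ`, `deriv (deriv ζ)` at `ρ t x`), divisions by `ρ, ρ², ρ₁, ρ₁²`, FIRST derivatives of
all fields and SECOND derivatives `∂ₗ∂ᵢ` (`Torus.partialDeriv l (Torus.partialDeriv i ·)`) of the
REFERENCE only. Convention: the first derivatives of the differences are kept as derivatives of
the difference, `∂ₗδρ = Torus.partialDeriv l (fun y => ρ t y - ρ₁ t y) x`,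
`∂ₗδuᵢ = Torus.partialDeriv l (fun y => u t y i - u₁ t y i) x` (the level-1 unknowns), while
`∂ₗθ, ∂ₗρ, ∂ₗθ₁, ∂ₗρ₁` inside the equation-of-state brackets are the plain slice derivatives.
Proofs: every field is a smooth slice (`IsSmoothSpaceTimeOn.isSmooth_slice`,
`IsSmooth.partialDeriv` for the reference gradients), so `∂ₗ` is the derivative along the `l`-th
coordinate line (`hasDerivAt_coordLine`, chain rule `hasDerivAt_coordLine_comp` for `ζ(ρ)` and
`ζ'(ρ)` with `ContDiffOn.deriv_of_isOpen`, Mathlib's `HasDerivAt` product/quotient rules,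
`ρ, ρ₁ > 0`), read off by `partialDeriv_eq_of_hasDerivAt` and matched by `field_simp`/`ring`.
No equation of motion is used.
-/

noncomputable section

namespace Summit.AtomisticToContinuum.HydrodynamicLimit.Theorems

open Set Filter Topology MeasureTheory
open scoped ContDiff
open Literature.MathematicalPhysics.KineticTheory Literature.Analysis.FunctionSpaces

section Level1Expansion

/-- **Level-1 expansion, density component.** For a classical hard-sphere–Euler solution
`(ρ, u, θ)` and an ideal-gas reference solution `(ρ₁, u₁, θ₁)` on `[0, T) × 𝕋³`, the right-hand
side `f_ρ = -(ρ - ρ₁) Σᵢ ∂ᵢu₁ᵢ - Σᵢ (uᵢ - u₁ᵢ) ∂ᵢρ₁` of the density difference equation has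
`∂ₗf_ρ = -∂ₗ(ρ - ρ₁) Σᵢ ∂ᵢu₁ᵢ - (ρ - ρ₁) Σᵢ ∂ₗ∂ᵢu₁ᵢ - Σᵢ ∂ₗ(uᵢ - u₁ᵢ) ∂ᵢρ₁ - Σᵢ (uᵢ - u₁ᵢ) ∂ₗ∂ᵢρ₁`
pointwise, for every direction `l` (Leibniz along the `l`-th coordinate line). [folklore] -/
theorem hsEuler_difference_rhs_deriv_density :
    ∀ {σ T : ℝ} {ρ θ ρ₁ θ₁ : ℝ → T3 → ℝ} {u u₁ : ℝ → T3 → V3},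
      IsHardSphereEulerSolution σ T ρ u θ → IsHardSphereEulerSolution 0 T ρ₁ u₁ θ₁ →
      ∀ {t : ℝ}, t ∈ Ico 0 T → ∀ (x : T3) (l : Fin 3),
        Torus.partialDeriv l (fun y =>
            -((ρ t y - ρ₁ t y) * ∑ i, Torus.partialDeriv i (fun z => u₁ t z i) y) -
              ∑ i, (u t y i - u₁ t y i) * Torus.partialDeriv i (ρ₁ t) y) x =
          -(Torus.partialDeriv l (fun y => ρ t y - ρ₁ t y) x *
                ∑ i, Torus.partialDeriv i (fun y => u₁ t y i) x) -
              (ρ t x - ρ₁ t x) *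
                ∑ i, Torus.partialDeriv l (Torus.partialDeriv i (fun y => u₁ t y i)) x -
            ∑ i, Torus.partialDeriv l (fun y => u t y i - u₁ t y i) x *
                Torus.partialDeriv i (ρ₁ t) x -
            ∑ i, (u t x i - u₁ t x i) * Torus.partialDeriv l (Torus.partialDeriv i (ρ₁ t)) x := by
  intro σ T ρ θ ρ₁ θ₁ u u₁ hE hE₁ t ht x l
  -- `C¹` slices of the two solutions and of the first derivatives of the reference
  have hρ1 : Torus.IsContDiff 1 (ρ t) := (hE.smooth_density.isSmooth_slice ht).isContDiff (by simp)
  have hρ1₁ : Torus.IsContDiff 1 (ρ₁ t) :=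
    (hE₁.smooth_density.isSmooth_slice ht).isContDiff (by simp)
  have hu1 : Torus.IsContDiff 1 (u t) := (hE.smooth_velocity.isSmooth_slice ht).isContDiff (by simp)
  have hu1₁ : Torus.IsContDiff 1 (u₁ t) :=
    (hE₁.smooth_velocity.isSmooth_slice ht).isContDiff (by simp)
  have hδρ1 : Torus.IsContDiff 1 (fun y => ρ t y - ρ₁ t y) := (hρ1.sub hρ1₁ :)
  have hδu1 : ∀ i, Torus.IsContDiff 1 (fun y => u t y i - u₁ t y i) :=
    fun i => ((isContDiff_apply_coord hu1 i).sub (isContDiff_apply_coord hu1₁ i) :)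
  have hDρ₁ : ∀ i, Torus.IsContDiff 1 (Torus.partialDeriv i (ρ₁ t)) :=
    fun i => ((hE₁.smooth_density.isSmooth_slice ht).partialDeriv i).isContDiff (by simp)
  have hDu₁ : ∀ i k, Torus.IsContDiff 1 (Torus.partialDeriv i (fun y => u₁ t y k)) :=
    fun i k => (((hE₁.smooth_velocity.isSmooth_slice ht).apply k).partialDeriv i).isContDiff
      (by simp)
  -- derivatives along the `l`-th coordinate line through `x`
  have cδρ := hasDerivAt_coordLine hδρ1 x l
  have cδu := fun i => hasDerivAt_coordLine (hδu1 i) x l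
  have cDρ₁ := fun i => hasDerivAt_coordLine (hDρ₁ i) x l
  have cDu₁ := fun i k => hasDerivAt_coordLine (hDu₁ i k) x l
  simp only [Fin.sum_univ_three]
  have hd := (cδρ.fun_mul (((cDu₁ 0 0).fun_add (cDu₁ 1 1)).fun_add (cDu₁ 2 2))).fun_neg.fun_sub
    ((((cδu 0).fun_mul (cDρ₁ 0)).fun_add ((cδu 1).fun_mul (cDρ₁ 1))).fun_add
      ((cδu 2).fun_mul (cDρ₁ 2)))
  refine (partialDeriv_eq_of_hasDerivAt hd).trans ?_
  simp only [zero_smul, Torus.proj_zero, add_zero]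
  ring

/-- **Level-1 expansion, velocity component.** For a classical hard-sphere–Euler solution
`(ρ, u, θ)` with density valued in an open set on which `ζ` is smooth and an ideal-gas reference
solution `(ρ₁, u₁, θ₁)` on `[0, T) × 𝕋³`, the right-hand side
`f_uⱼ = -Σᵢ (uᵢ - u₁ᵢ) ∂ᵢu₁ⱼ - (θ γ(ρ)/ρ - θ₁/ρ₁) ∂ⱼρ₁ - (ζ(ρ) - 1) ∂ⱼθ₁` (`γ = ζ + id·ζ'`) of
the `j`-th velocity difference equation has, for every direction `l`,
`∂ₗf_uⱼ = -Σᵢ ∂ₗ(uᵢ - u₁ᵢ) ∂ᵢu₁ⱼ - Σᵢ (uᵢ - u₁ᵢ) ∂ₗ∂ᵢu₁ⱼ`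
`  - ((∂ₗθ γ(ρ) + θ (2ζ'(ρ) + ρ ζ''(ρ)) ∂ₗρ)/ρ - θ γ(ρ) ∂ₗρ/ρ² - (∂ₗθ₁/ρ₁ - θ₁ ∂ₗρ₁/ρ₁²)) ∂ⱼρ₁`
`  - (θ γ(ρ)/ρ - θ₁/ρ₁) ∂ₗ∂ⱼρ₁ - ζ'(ρ) ∂ₗρ ∂ⱼθ₁ - (ζ(ρ) - 1) ∂ₗ∂ⱼθ₁`
pointwise (Leibniz, quotient and chain rules along the `l`-th coordinate line; `ρ, ρ₁ > 0`).
[folklore] -/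
theorem hsEuler_difference_rhs_deriv_velocity :
    ∀ {σ T : ℝ} {ρ θ ρ₁ θ₁ : ℝ → T3 → ℝ} {u u₁ : ℝ → T3 → V3} {ζ : ℝ → ℝ} {J : Set ℝ},
      IsHardSphereEulerSolution σ T ρ u θ → IsHardSphereEulerSolution 0 T ρ₁ u₁ θ₁ → IsOpen J →
      ContDiffOn ℝ (⊤ : ℕ∞) ζ J → (∀ t ∈ Ico 0 T, ∀ x, ρ t x ∈ J) →
      ∀ {t : ℝ}, t ∈ Ico 0 T → ∀ (x : T3) (l j : Fin 3),
        Torus.partialDeriv l (fun y =>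
            -(∑ i, (u t y i - u₁ t y i) * Torus.partialDeriv i (fun z => u₁ t z j) y) -
              (θ t y * (ζ (ρ t y) + ρ t y * deriv ζ (ρ t y)) / ρ t y - θ₁ t y / ρ₁ t y) *
                Torus.partialDeriv j (ρ₁ t) y -
              (ζ (ρ t y) - 1) * Torus.partialDeriv j (θ₁ t) y) x =
          -(∑ i, Torus.partialDeriv l (fun y => u t y i - u₁ t y i) x *
                Torus.partialDeriv i (fun y => u₁ t y j) x) -
              ∑ i, (u t x i - u₁ t x i) *
                Torus.partialDeriv l (Torus.partialDeriv i (fun y => u₁ t y j)) x -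
            ((Torus.partialDeriv l (θ t) x * (ζ (ρ t x) + ρ t x * deriv ζ (ρ t x)) +
                    θ t x * (2 * deriv ζ (ρ t x) + ρ t x * deriv (deriv ζ) (ρ t x)) *
                      Torus.partialDeriv l (ρ t) x) / ρ t x -
                  θ t x * (ζ (ρ t x) + ρ t x * deriv ζ (ρ t x)) * Torus.partialDeriv l (ρ t) x /
                    ρ t x ^ 2 -
                (Torus.partialDeriv l (θ₁ t) x / ρ₁ t x -
                  θ₁ t x * Torus.partialDeriv l (ρ₁ t) x / ρ₁ t x ^ 2)) *
              Torus.partialDeriv j (ρ₁ t) x -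
            (θ t x * (ζ (ρ t x) + ρ t x * deriv ζ (ρ t x)) / ρ t x - θ₁ t x / ρ₁ t x) *
              Torus.partialDeriv l (Torus.partialDeriv j (ρ₁ t)) x -
            deriv ζ (ρ t x) * Torus.partialDeriv l (ρ t) x * Torus.partialDeriv j (θ₁ t) x -
            (ζ (ρ t x) - 1) * Torus.partialDeriv l (Torus.partialDeriv j (θ₁ t)) x := by
  intro σ T ρ θ ρ₁ θ₁ u u₁ ζ J hE hE₁ hJ hζ hρJ t ht x l j
  -- `C¹` slices of the two solutions and of the first derivatives of the reference
  have hρ1 : Torus.IsContDiff 1 (ρ t) := (hE.smooth_density.isSmooth_slice ht).isContDiff (by simp)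
  have hθ1 : Torus.IsContDiff 1 (θ t) :=
    (hE.smooth_temperature.isSmooth_slice ht).isContDiff (by simp)
  have hρ1₁ : Torus.IsContDiff 1 (ρ₁ t) :=
    (hE₁.smooth_density.isSmooth_slice ht).isContDiff (by simp)
  have hθ1₁ : Torus.IsContDiff 1 (θ₁ t) :=
    (hE₁.smooth_temperature.isSmooth_slice ht).isContDiff (by simp)
  have hu1 : Torus.IsContDiff 1 (u t) := (hE.smooth_velocity.isSmooth_slice ht).isContDiff (by simp)
  have hu1₁ : Torus.IsContDiff 1 (u₁ t) :=
    (hE₁.smooth_velocity.isSmooth_slice ht).isContDiff (by simp)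
  have hδu1 : ∀ i, Torus.IsContDiff 1 (fun y => u t y i - u₁ t y i) :=
    fun i => ((isContDiff_apply_coord hu1 i).sub (isContDiff_apply_coord hu1₁ i) :)
  have hDρ₁ : Torus.IsContDiff 1 (Torus.partialDeriv j (ρ₁ t)) :=
    ((hE₁.smooth_density.isSmooth_slice ht).partialDeriv j).isContDiff (by simp)
  have hDθ₁ : Torus.IsContDiff 1 (Torus.partialDeriv j (θ₁ t)) :=
    ((hE₁.smooth_temperature.isSmooth_slice ht).partialDeriv j).isContDiff (by simp)
  have hDu₁ : ∀ i, Torus.IsContDiff 1 (Torus.partialDeriv i (fun y => u₁ t y j)) :=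
    fun i => (((hE₁.smooth_velocity.isSmooth_slice ht).apply j).partialDeriv i).isContDiff
      (by simp)
  have hζ' : ContDiffOn ℝ ∞ (deriv ζ) J := hζ.deriv_of_isOpen (m := ∞) hJ le_rfl
  have hxJ : ρ t x ∈ J := hρJ t ht x
  -- non-vanishing of the densities on the coordinate line (at parameter `0`)
  have hρ0 : ρ t x ≠ 0 := (hE.density_pos t ht x).ne'
  have hρ0₁ : ρ₁ t x ≠ 0 := (hE₁.density_pos t ht x).ne'
  have hρ0' : ρ t (x + Torus.proj ((0 : ℝ) • EuclideanSpace.single l (1 : ℝ))) ≠ 0 := by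
    simpa using hρ0
  have hρ0₁' : ρ₁ t (x + Torus.proj ((0 : ℝ) • EuclideanSpace.single l (1 : ℝ))) ≠ 0 := by
    simpa using hρ0₁
  -- derivatives along the `l`-th coordinate line through `x`
  have cρ := hasDerivAt_coordLine hρ1 x l
  have cθ := hasDerivAt_coordLine hθ1 x l
  have cρ₁ := hasDerivAt_coordLine hρ1₁ x l
  have cθ₁ := hasDerivAt_coordLine hθ1₁ x l
  have cδu := fun i => hasDerivAt_coordLine (hδu1 i) x l
  have cDu₁ := fun i => hasDerivAt_coordLine (hDu₁ i) x l
  have cDρ₁ := hasDerivAt_coordLine hDρ₁ x l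
  have cDθ₁ := hasDerivAt_coordLine hDθ₁ x l
  have cζ := hasDerivAt_coordLine_comp hρ1 hJ hζ x hxJ l
  have cζ' := hasDerivAt_coordLine_comp hρ1 hJ hζ' x hxJ l
  simp only [Fin.sum_univ_three]
  have hd := (((((cδu 0).fun_mul (cDu₁ 0)).fun_add ((cδu 1).fun_mul (cDu₁ 1))).fun_add
    ((cδu 2).fun_mul (cDu₁ 2))).fun_neg.fun_sub ((((cθ.fun_mul (cζ.fun_add
    (cρ.fun_mul cζ'))).fun_div cρ hρ0').fun_sub (cθ₁.fun_div cρ₁ hρ0₁')).fun_mul cDρ₁)).fun_sub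
    ((cζ.sub_const 1).fun_mul cDθ₁)
  refine (partialDeriv_eq_of_hasDerivAt hd).trans ?_
  simp only [zero_smul, Torus.proj_zero, add_zero]
  field_simp
  ring

/-- **Level-1 expansion, temperature component.** For a classical hard-sphere–Euler solution
`(ρ, u, θ)` with density valued in an open set on which `ζ` is smooth and an ideal-gas reference
solution `(ρ₁, u₁, θ₁)` on `[0, T) × 𝕋³`, the right-hand side
`f_θ = -Σᵢ (uᵢ - u₁ᵢ) ∂ᵢθ₁ - (2/3) (θ ζ(ρ) - θ₁) Σᵢ ∂ᵢu₁ᵢ` of the temperature difference equation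
has, for every direction `l`,
`∂ₗf_θ = -Σᵢ ∂ₗ(uᵢ - u₁ᵢ) ∂ᵢθ₁ - Σᵢ (uᵢ - u₁ᵢ) ∂ₗ∂ᵢθ₁`
`  - (2/3) (∂ₗθ ζ(ρ) + θ ζ'(ρ) ∂ₗρ - ∂ₗθ₁) Σᵢ ∂ᵢu₁ᵢ - (2/3) (θ ζ(ρ) - θ₁) Σᵢ ∂ₗ∂ᵢu₁ᵢ`
pointwise (Leibniz and chain rules along the `l`-th coordinate line). [folklore] -/
theorem hsEuler_difference_rhs_deriv_temperature :
    ∀ {σ T : ℝ} {ρ θ ρ₁ θ₁ : ℝ → T3 → ℝ} {u u₁ : ℝ → T3 → V3} {ζ : ℝ → ℝ} {J : Set ℝ},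
      IsHardSphereEulerSolution σ T ρ u θ → IsHardSphereEulerSolution 0 T ρ₁ u₁ θ₁ → IsOpen J →
      ContDiffOn ℝ (⊤ : ℕ∞) ζ J → (∀ t ∈ Ico 0 T, ∀ x, ρ t x ∈ J) →
      ∀ {t : ℝ}, t ∈ Ico 0 T → ∀ (x : T3) (l : Fin 3),
        Torus.partialDeriv l (fun y =>
            -(∑ i, (u t y i - u₁ t y i) * Torus.partialDeriv i (θ₁ t) y) -
              2 / 3 * (θ t y * ζ (ρ t y) - θ₁ t y) *
                ∑ i, Torus.partialDeriv i (fun z => u₁ t z i) y) x =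
          -(∑ i, Torus.partialDeriv l (fun y => u t y i - u₁ t y i) x *
                Torus.partialDeriv i (θ₁ t) x) -
              ∑ i, (u t x i - u₁ t x i) * Torus.partialDeriv l (Torus.partialDeriv i (θ₁ t)) x -
            2 / 3 * (Torus.partialDeriv l (θ t) x * ζ (ρ t x) +
                  θ t x * deriv ζ (ρ t x) * Torus.partialDeriv l (ρ t) x -
                Torus.partialDeriv l (θ₁ t) x) *
              ∑ i, Torus.partialDeriv i (fun y => u₁ t y i) x -
            2 / 3 * (θ t x * ζ (ρ t x) - θ₁ t x) *
              ∑ i, Torus.partialDeriv l (Torus.partialDeriv i (fun y => u₁ t y i)) x := by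
  intro σ T ρ θ ρ₁ θ₁ u u₁ ζ J hE hE₁ hJ hζ hρJ t ht x l
  -- `C¹` slices of the two solutions and of the first derivatives of the reference
  have hρ1 : Torus.IsContDiff 1 (ρ t) := (hE.smooth_density.isSmooth_slice ht).isContDiff (by simp)
  have hθ1 : Torus.IsContDiff 1 (θ t) :=
    (hE.smooth_temperature.isSmooth_slice ht).isContDiff (by simp)
  have hθ1₁ : Torus.IsContDiff 1 (θ₁ t) :=
    (hE₁.smooth_temperature.isSmooth_slice ht).isContDiff (by simp)
  have hu1 : Torus.IsContDiff 1 (u t) := (hE.smooth_velocity.isSmooth_slice ht).isContDiff (by simp)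
  have hu1₁ : Torus.IsContDiff 1 (u₁ t) :=
    (hE₁.smooth_velocity.isSmooth_slice ht).isContDiff (by simp)
  have hδu1 : ∀ i, Torus.IsContDiff 1 (fun y => u t y i - u₁ t y i) :=
    fun i => ((isContDiff_apply_coord hu1 i).sub (isContDiff_apply_coord hu1₁ i) :)
  have hDθ₁ : ∀ i, Torus.IsContDiff 1 (Torus.partialDeriv i (θ₁ t)) :=
    fun i => ((hE₁.smooth_temperature.isSmooth_slice ht).partialDeriv i).isContDiff (by simp)
  have hDu₁ : ∀ i k, Torus.IsContDiff 1 (Torus.partialDeriv i (fun y => u₁ t y k)) :=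
    fun i k => (((hE₁.smooth_velocity.isSmooth_slice ht).apply k).partialDeriv i).isContDiff
      (by simp)
  have hxJ : ρ t x ∈ J := hρJ t ht x
  -- derivatives along the `l`-th coordinate line through `x`
  have cρ := hasDerivAt_coordLine hρ1 x l
  have cθ := hasDerivAt_coordLine hθ1 x l
  have cθ₁ := hasDerivAt_coordLine hθ1₁ x l
  have cδu := fun i => hasDerivAt_coordLine (hδu1 i) x l
  have cDθ₁ := fun i => hasDerivAt_coordLine (hDθ₁ i) x l
  have cDu₁ := fun i k => hasDerivAt_coordLine (hDu₁ i k) x l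
  have cζ := hasDerivAt_coordLine_comp hρ1 hJ hζ x hxJ l
  simp only [Fin.sum_univ_three]
  have hd := ((((cδu 0).fun_mul (cDθ₁ 0)).fun_add ((cδu 1).fun_mul (cDθ₁ 1))).fun_add
    ((cδu 2).fun_mul (cDθ₁ 2))).fun_neg.fun_sub ((((cθ.fun_mul cζ).fun_sub cθ₁).const_mul
    (2 / 3)).fun_mul (((cDu₁ 0 0).fun_add (cDu₁ 1 1)).fun_add (cDu₁ 2 2)))
  refine (partialDeriv_eq_of_hasDerivAt hd).trans ?_
  simp only [zero_smul, Torus.proj_zero, add_zero]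
  ring

end Level1Expansion

end Summit.AtomisticToContinuum.HydrodynamicLimit.Theorems

end
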